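import Summits.NavierStokesRegularity.FunctionalMining.NoGo.TopBotEigHeatCoerciveGtTwo
import Mathlib.Analysis.MeanInequalities
import HarnessLib

/-!
# K20a — the share window of the symmetrised top–bottom density is a DOWN-SET (downward closure),
# every real `q ≥ 1`

search for candidate a priori estimates; no regularity claim.

No-go branch (door D-K6 (c)), kernel side, every real `q ≥ 1`; imports the TREE only (fileable at
once).
The share window of the typed finite-dimensional obligation `TopBotEigSplitting q c`
(`NoGo/TopBotEigHeatCoerciveSplit`) is the set `{c : ℝ | TopBotEigSplitting q c}`. The tree knows an
interior point `shareConst q` for `q ≥ 2` (K10c) and the ceiling `2/9` at `q = 4` (K14); staged are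
the
ceiling `c_axi(q)` for `q > 1` (K16), the sharp `2/9` at `q = 4` (K17) and the one-dimensional
attainment criterion (K18/K19). This file adds the missing elementary structure:

* §1 `lqPair q u v = (u^q + v^q)^{1/q}`, the two-term `ℓ^q` gauge: monotone, positively homogeneous,
  and subadditive for `q ≥ 1` (Minkowski, Mathlib `Real.Lp_add_le` on `Fin 2`).
* §2 **Downward closure** `topBotEigSplitting_of_le : 1 ≤ q → c' ≤ c → TopBotEigSplitting q c →
  TopBotEigSplitting q c'`: absorb the surplus `(c − c')·‖A‖^q` into the gauge — the new gauge is
  `A ↦ lqPair q (M^{1/q}·max (h A) 0) ((c−c')^{1/q}·‖A‖)`, rescaled by `(M + c − c')^{1/q}`; it is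
  convex (monotonicity + Minkowski + homogeneity) and `1`-Lipschitz (the same three facts). Hence
  the window is a lower set (`isLowerSet_topBotEigSplitting`), and `= Iic c₀` as soon as it has a
  greatest element `c₀` (`topBotEigSplitting_window_of_isGreatest`).
* §3 Tree-only corollaries, every real `q ≥ 2`: `Iic (shareConst q) ⊆ {c | TopBotEigSplitting q c}`
  (K10c's share and everything below it split).

The companion K20b (`NoGo/TopBotEigSplitShareWindow`) combines §2 with K16/K17/K19: the window is
`Iic (c_axi(q))` modulo K19's three sign conditions, and `Iic (2/9)` at `q = 4` unconditionally.
NOT claimed: anything on `heatDissipation`, `TopEigHeatCoercivePos`, `NegBotEigHeatCoercivePos`; the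
verdict of record L-λ(q) stays OPEN (kernel) for every real `q > 1`. [ours, elementary]
FILING (prove seat g26, REQUEST #35 (K20a: nogo g43 touch 6, HOME INBOX l.4713; LEAD RULING (λλ)(i) l.4718: slot #35 LOW, fileable now, independent of the K14 chain)): declarations byte-identical to the no-go seat's staged `TopBotEigSplitShareClosure.STAGING.lean` df39faca7564b162; this line is the only addition.
-/

noncomputable section

open Set Real

namespace Summit.NavierStokesRegularity.FunctionalMining

namespace TopEig

/-! ## 1. The two-term `ℓ^q` gauge -/

section lqPair

/-- The two-term `ℓ^q` gauge `(u^q + v^q)^{1/q}` (used for `u, v ≥ 0`). [ours, bookkeeping] -/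
def lqPair (q u v : ℝ) : ℝ := (u ^ q + v ^ q) ^ q⁻¹

/-- `lqPair q u v ≥ 0` for `u, v ≥ 0`. [ours, bookkeeping] -/
theorem lqPair_nonneg (q : ℝ) {u v : ℝ} (hu : 0 ≤ u) (hv : 0 ≤ v) : 0 ≤ lqPair q u v :=
  rpow_nonneg (add_nonneg (rpow_nonneg hu _) (rpow_nonneg hv _)) _

/-- Monotonicity of the gauge in both (non-negative) arguments, `q > 0`. [ours, elementary] -/
theorem lqPair_mono {q u u' v v' : ℝ} (hq : 0 < q) (hu : 0 ≤ u) (hv : 0 ≤ v) (huu : u ≤ u')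
    (hvv : v ≤ v') : lqPair q u v ≤ lqPair q u' v' := by
  unfold lqPair
  exact rpow_le_rpow (add_nonneg (rpow_nonneg hu _) (rpow_nonneg hv _))
    (add_le_add (rpow_le_rpow hu huu hq.le) (rpow_le_rpow hv hvv hq.le)) (inv_nonneg.mpr hq.le)

/-- Positive homogeneity: `lqPair q (t u) (t v) = t · lqPair q u v` for `t, u, v ≥ 0`, `q > 0`.
[ours, elementary] -/
theorem lqPair_smul {q t u v : ℝ} (hq : 0 < q) (ht : 0 ≤ t) (hu : 0 ≤ u) (hv : 0 ≤ v) :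
    lqPair q (t * u) (t * v) = t * lqPair q u v := by
  unfold lqPair
  rw [mul_rpow ht hu, mul_rpow ht hv, ← mul_add,
    mul_rpow (rpow_nonneg ht _) (add_nonneg (rpow_nonneg hu _) (rpow_nonneg hv _)),
    rpow_rpow_inv ht hq.ne']

/-- The `q`-th power of the gauge: `(lqPair q u v)^q = u^q + v^q` for `u, v ≥ 0`, `q > 0`.
[ours, bookkeeping] -/
theorem lqPair_rpow {q u v : ℝ} (hq : 0 < q) (hu : 0 ≤ u) (hv : 0 ≤ v) :
    lqPair q u v ^ q = u ^ q + v ^ q := by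
  unfold lqPair
  exact rpow_inv_rpow (add_nonneg (rpow_nonneg hu _) (rpow_nonneg hv _)) hq.ne'

/-- **Minkowski for two terms**: the gauge is subadditive on the non-negative quadrant for `q ≥ 1`.
[Mathlib `Real.Lp_add_le` on `Fin 2`] -/
theorem lqPair_add_le {q a₁ a₂ b₁ b₂ : ℝ} (hq : 1 ≤ q) (ha₁ : 0 ≤ a₁) (ha₂ : 0 ≤ a₂)
    (hb₁ : 0 ≤ b₁) (hb₂ : 0 ≤ b₂) :
    lqPair q (a₁ + b₁) (a₂ + b₂) ≤ lqPair q a₁ a₂ + lqPair q b₁ b₂ := by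
  have h := Real.Lp_add_le (Finset.univ : Finset (Fin 2)) ![a₁, a₂] ![b₁, b₂] hq
  simp only [Fin.sum_univ_two, Matrix.cons_val_zero, Matrix.cons_val_one, abs_of_nonneg ha₁,
    abs_of_nonneg ha₂, abs_of_nonneg hb₁, abs_of_nonneg hb₂,
    abs_of_nonneg (add_nonneg ha₁ hb₁), abs_of_nonneg (add_nonneg ha₂ hb₂), one_div] at h
  simpa only [lqPair] using h

end lqPair

/-! ## 2. Downward closure of the share window -/

section closure

/-- **Downward closure of the share window**, every real `q ≥ 1`: if `TopBotEigSplitting q c` and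
`c' ≤ c` then `TopBotEigSplitting q c'`. Proof: with the witness `(M, h)` for `c` and
`k = c − c' ≥ 0`, the function `Φ(A) = lqPair q (M^{1/q}·max (h A) 0) (k^{1/q}·‖A‖)` is convex and
`(M+k)^{1/q}`-Lipschitz
(monotonicity, Minkowski, homogeneity of `lqPair`), and on symmetric trace-free `A` one has
`Φ(A)^q = M·h(A)^q + k·‖A‖^q`; the witness for `c'` is `(M + k, Φ/(M+k)^{1/q})`.
[ours, elementary] -/
theorem topBotEigSplitting_of_le {q c c' : ℝ} (hq : 1 ≤ q) (hcc : c' ≤ c)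
    (hs : TopBotEigSplitting q c) : TopBotEigSplitting q c' := by
  obtain ⟨M, hM, h, hconv, hlip, hall⟩ := hs
  obtain ⟨k, hk, rfl⟩ : ∃ k : ℝ, 0 ≤ k ∧ c' = c - k := ⟨c - c', by linarith, by ring⟩
  have hq0 : 0 < q := by linarith
  rcases (add_nonneg hM hk).eq_or_lt with hL0 | hLpos
  · have hk0 : k = 0 := by linarith
    rw [hk0, sub_zero]
    exact ⟨M, hM, h, hconv, hlip, hall⟩
  -- the main case `0 < M + k`
  have hmq : 0 ≤ M ^ q⁻¹ := rpow_nonneg hM _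
  have hkq : 0 ≤ k ^ q⁻¹ := rpow_nonneg hk _
  have hLpos' : 0 < (M + k) ^ q⁻¹ := rpow_pos_of_pos hLpos _
  have hL : lqPair q (M ^ q⁻¹) (k ^ q⁻¹) = (M + k) ^ q⁻¹ := by
    unfold lqPair; rw [rpow_inv_rpow hM hq0.ne', rpow_inv_rpow hk hq0.ne']
  -- the positive part of `h`: convex, `1`-Lipschitz, non-negative
  have hpos_conv : ∀ x y : EuclideanSpace ℝ (Fin 3 × Fin 3), ∀ a b : ℝ, 0 ≤ a → 0 ≤ b →
      a + b = 1 → max (h (a • x + b • y)) 0 ≤ a * max (h x) 0 + b * max (h y) 0 := by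
    intro x y a b ha hb hab
    have hc := hconv.2 (mem_univ x) (mem_univ y) ha hb hab
    simp only [smul_eq_mul] at hc
    refine max_le ?_ (by positivity)
    calc h (a • x + b • y) ≤ a * h x + b * h y := hc
      _ ≤ a * max (h x) 0 + b * max (h y) 0 := by
        gcongr
        · exact le_max_left _ _
        · exact le_max_left _ _
  have hpos_lip : ∀ x y : EuclideanSpace ℝ (Fin 3 × Fin 3),
      max (h x) 0 ≤ max (h y) 0 + ‖x - y‖ := by
    intro x y
    have h1 := hlip.le_add_mul x y
    simp only [NNReal.coe_one, one_mul, dist_eq_norm] at h1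
    refine max_le ?_ (by positivity)
    calc h x ≤ h y + ‖x - y‖ := h1
      _ ≤ max (h y) 0 + ‖x - y‖ := by gcongr; exact le_max_left _ _
  have hnorm_conv : ∀ x y : EuclideanSpace ℝ (Fin 3 × Fin 3), ∀ a b : ℝ, 0 ≤ a → 0 ≤ b →
      ‖a • x + b • y‖ ≤ a * ‖x‖ + b * ‖y‖ := by
    intro x y a b ha hb
    calc ‖a • x + b • y‖ ≤ ‖a • x‖ + ‖b • y‖ := norm_add_le _ _
      _ = a * ‖x‖ + b * ‖y‖ := by rw [norm_smul, norm_smul, Real.norm_of_nonneg ha,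
          Real.norm_of_nonneg hb]
  have hnorm_lip : ∀ x y : EuclideanSpace ℝ (Fin 3 × Fin 3), ‖x‖ ≤ ‖y‖ + ‖x - y‖ := by
    intro x y
    calc ‖x‖ = ‖y + (x - y)‖ := by rw [add_sub_cancel]
      _ ≤ ‖y‖ + ‖x - y‖ := norm_add_le _ _
  -- the new gauge
  refine ⟨M + k, hLpos.le,
    fun A => lqPair q (M ^ q⁻¹ * max (h A) 0) (k ^ q⁻¹ * ‖A‖) / (M + k) ^ q⁻¹, ?_, ?_, ?_⟩
  · -- convexity
    refine ⟨convex_univ, ?_⟩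
    intro x _ y _ a b ha hb hab
    simp only [smul_eq_mul]
    have hm := hpos_conv x y a b ha hb hab
    have hn := hnorm_conv x y a b ha hb
    have step1 : lqPair q (M ^ q⁻¹ * max (h (a • x + b • y)) 0) (k ^ q⁻¹ * ‖a • x + b • y‖) ≤
        lqPair q (a * (M ^ q⁻¹ * max (h x) 0) + b * (M ^ q⁻¹ * max (h y) 0))
          (a * (k ^ q⁻¹ * ‖x‖) + b * (k ^ q⁻¹ * ‖y‖)) := by
      have e1 : a * (M ^ q⁻¹ * max (h x) 0) + b * (M ^ q⁻¹ * max (h y) 0) =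
          M ^ q⁻¹ * (a * max (h x) 0 + b * max (h y) 0) := by ring
      have e2 : a * (k ^ q⁻¹ * ‖x‖) + b * (k ^ q⁻¹ * ‖y‖) = k ^ q⁻¹ * (a * ‖x‖ + b * ‖y‖) := by
        ring
      rw [e1, e2]
      exact lqPair_mono hq0 (mul_nonneg hmq (le_max_right _ _)) (mul_nonneg hkq (norm_nonneg _))
        (mul_le_mul_of_nonneg_left hm hmq) (mul_le_mul_of_nonneg_left hn hkq)
    have step2 := lqPair_add_le hq (mul_nonneg ha (mul_nonneg hmq (le_max_right (h x) 0)))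
      (mul_nonneg ha (mul_nonneg hkq (norm_nonneg x)))
      (mul_nonneg hb (mul_nonneg hmq (le_max_right (h y) 0)))
      (mul_nonneg hb (mul_nonneg hkq (norm_nonneg y)))
    rw [lqPair_smul hq0 ha (mul_nonneg hmq (le_max_right _ _)) (mul_nonneg hkq (norm_nonneg _)),
      lqPair_smul hq0 hb (mul_nonneg hmq (le_max_right _ _)) (mul_nonneg hkq (norm_nonneg _))]
      at step2
    have := step1.trans step2
    calc lqPair q (M ^ q⁻¹ * max (h (a • x + b • y)) 0) (k ^ q⁻¹ * ‖a • x + b • y‖) / (M + k) ^ q⁻¹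
        ≤ (a * lqPair q (M ^ q⁻¹ * max (h x) 0) (k ^ q⁻¹ * ‖x‖) +
            b * lqPair q (M ^ q⁻¹ * max (h y) 0) (k ^ q⁻¹ * ‖y‖)) / (M + k) ^ q⁻¹ :=
          div_le_div_of_nonneg_right this hLpos'.le
      _ = a * (lqPair q (M ^ q⁻¹ * max (h x) 0) (k ^ q⁻¹ * ‖x‖) / (M + k) ^ q⁻¹) +
            b * (lqPair q (M ^ q⁻¹ * max (h y) 0) (k ^ q⁻¹ * ‖y‖) / (M + k) ^ q⁻¹) := by ring
  · -- `1`-Lipschitz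
    refine LipschitzWith.of_le_add fun x y => ?_
    rw [dist_eq_norm]
    have hm := hpos_lip x y
    have hn := hnorm_lip x y
    have step1 : lqPair q (M ^ q⁻¹ * max (h x) 0) (k ^ q⁻¹ * ‖x‖) ≤
        lqPair q (M ^ q⁻¹ * max (h y) 0 + ‖x - y‖ * M ^ q⁻¹)
          (k ^ q⁻¹ * ‖y‖ + ‖x - y‖ * k ^ q⁻¹) := by
      have e1 : M ^ q⁻¹ * max (h y) 0 + ‖x - y‖ * M ^ q⁻¹ = M ^ q⁻¹ * (max (h y) 0 + ‖x - y‖) := by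
        ring
      have e2 : k ^ q⁻¹ * ‖y‖ + ‖x - y‖ * k ^ q⁻¹ = k ^ q⁻¹ * (‖y‖ + ‖x - y‖) := by ring
      rw [e1, e2]
      exact lqPair_mono hq0 (mul_nonneg hmq (le_max_right _ _)) (mul_nonneg hkq (norm_nonneg _))
        (mul_le_mul_of_nonneg_left hm hmq) (mul_le_mul_of_nonneg_left hn hkq)
    have step2 := lqPair_add_le hq (mul_nonneg hmq (le_max_right (h y) 0))
      (mul_nonneg hkq (norm_nonneg y)) (mul_nonneg (norm_nonneg (x - y)) hmq)
      (mul_nonneg (norm_nonneg (x - y)) hkq)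
    rw [lqPair_smul hq0 (norm_nonneg _) hmq hkq, hL] at step2
    have := step1.trans step2
    calc lqPair q (M ^ q⁻¹ * max (h x) 0) (k ^ q⁻¹ * ‖x‖) / (M + k) ^ q⁻¹
        ≤ (lqPair q (M ^ q⁻¹ * max (h y) 0) (k ^ q⁻¹ * ‖y‖) + ‖x - y‖ * (M + k) ^ q⁻¹) /
            (M + k) ^ q⁻¹ := div_le_div_of_nonneg_right this hLpos'.le
      _ = lqPair q (M ^ q⁻¹ * max (h y) 0) (k ^ q⁻¹ * ‖y‖) / (M + k) ^ q⁻¹ + ‖x - y‖ := by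
          field_simp
  · -- the identity on symmetric trace-free matrices
    intro A hsym htr
    obtain ⟨hA0, hid⟩ := hall A hsym htr
    have hmax : max (h A) 0 = h A := max_eq_left hA0
    have hΦ : 0 ≤ lqPair q (M ^ q⁻¹ * max (h A) 0) (k ^ q⁻¹ * ‖A‖) :=
      lqPair_nonneg q (mul_nonneg hmq (le_max_right _ _)) (mul_nonneg hkq (norm_nonneg _))
    refine ⟨div_nonneg hΦ hLpos'.le, ?_⟩
    rw [div_rpow hΦ hLpos'.le, rpow_inv_rpow hLpos.le hq0.ne',
      lqPair_rpow hq0 (mul_nonneg hmq (le_max_right _ _)) (mul_nonneg hkq (norm_nonneg _)), hmax,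
      mul_rpow hmq hA0, mul_rpow hkq (norm_nonneg _), rpow_inv_rpow hM hq0.ne',
      rpow_inv_rpow hk hq0.ne', hid]
    have e : (M + k) * ((M * h A ^ q + k * ‖A‖ ^ q) / (M + k)) = M * h A ^ q + k * ‖A‖ ^ q := by
      field_simp
    rw [e]; ring

/-- **A window with a greatest element is the down-set `Iic`**, every real `q ≥ 1`.
[ours; downward closure] -/
theorem topBotEigSplitting_window_of_isGreatest {q c₀ : ℝ} (hq : 1 ≤ q)
    (hG : IsGreatest {c : ℝ | TopBotEigSplitting q c} c₀) :
    {c : ℝ | TopBotEigSplitting q c} = Iic c₀ :=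
  Set.ext fun _ => ⟨fun hc => hG.2 hc, fun hc => topBotEigSplitting_of_le hq hc hG.1⟩

/-- The window contains every `c ≤ 0` as soon as it is non-empty, `q ≥ 1`. [ours, bookkeeping] -/
theorem topBotEigSplitting_of_nonpos {q c c' : ℝ} (hq : 1 ≤ q) (hs : TopBotEigSplitting q c)
    (hc : 0 ≤ c) (hc' : c' ≤ 0) : TopBotEigSplitting q c' :=
  topBotEigSplitting_of_le hq (hc'.trans hc) hs

end closure

/-! ## 3. Tree-only corollaries, every real `q ≥ 2` -/

section tree

/-- **The window is a lower set**, every real `q ≥ 1`. [ours; downward closure] -/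
theorem isLowerSet_topBotEigSplitting {q : ℝ} (hq : 1 ≤ q) :
    IsLowerSet {c : ℝ | TopBotEigSplitting q c} :=
  fun _ _ hcc hc => topBotEigSplitting_of_le hq hcc hc

/-- Every share `c ≤ shareConst q` splits, every real `q ≥ 2` (tree K10c
`topBotEigSplitting_of_shareConst` + downward closure). [ours] -/
theorem topBotEigSplitting_of_le_shareConst {q c : ℝ} (hq : 2 ≤ q) (hc : c ≤ shareConst q) :
    TopBotEigSplitting q c :=
  topBotEigSplitting_of_le (by linarith) hc (topBotEigSplitting_of_shareConst hq)

/-- `Iic (shareConst q) ⊆ {c | TopBotEigSplitting q c}`, every real `q ≥ 2`. [ours, bookkeeping] -/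
theorem Iic_shareConst_subset_window {q : ℝ} (hq : 2 ≤ q) :
    Iic (shareConst q) ⊆ {c : ℝ | TopBotEigSplitting q c} :=
  fun _ hc => topBotEigSplitting_of_le_shareConst hq hc

end tree

end TopEig

end Summit.NavierStokesRegularity.FunctionalMining
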